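import Mathlib

/-!
# PneNP / ConvexRankGates — `ConvexGateBlind`, line `xor-door-perfect-completeness`: the derivation gadget

Helper file for the crux `ConvexGateBlind` (item `stmt-PneNP-10680`, `--supports`; closes nothing by
itself). It is the combinatorial core of the stub `stub_cliqueProjectsXor` (`3XOR-UNSAT` is a
polynomial monotone AND-projection of `CLIQUE`), kept free of the line's vocabulary: an equation of
the 3-sparse pool on `n` variables is an element `(a, b, c, β)` of `Fin n × Fin n × Fin n × ZMod 2`
(reducibly the line's `Pool n`), read `y a + y b + y c = β`.

* §1 Derivations of `0 = 1` over `𝔽₂`: `unsat_of_deriv` (a combination of selected equations with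
  zero variable part and right-hand side `1` refutes the selected system) and `exists_deriv_of_unsat`
  (conversely, by linear-algebra duality over the field `ZMod 2`, `Submodule.exists_le_ker_of_notMem`).
* §2 The DERIVATION GADGET on `L` steps enumerating equations `eqn : Fin L → …`: vertices `Vtx`
  = (step `j`, coordinate `i : Option (Fin n)` (`none` = right-hand side), state bit before, decision
  bit), the local rule `aft`, boundary conditions `Valid`, pairwise consistency `Compat` and the
  adjacency `Good` at an input `v` (used equations must be selected: the AND-mask).
  `unsat_of_family` / `family_of_deriv`: a pairwise-adjacent family with one vertex per position
  `(j, i)` is exactly a derivation of `0 = 1` from selected equations (decisions are constant along a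
  step, states telescope from `0` to the target `(0, …, 0 ∣ 1)`).
* §3 `M`, `eV` (the vertices as `Fin M`, `M ≤ 4 L (n + 1)`) and the clique characterisation
  `xorGadget_goodSet_iff`: for `n ≥ 1` and steps enumerating the whole pool, a set of `L (n + 1)`
  pairwise-adjacent vertices exists iff the selected system is unsatisfiable.

NOT here: the literals substituted for the edges of `K_M` and the stub theorem itself (they need the
line's `Lit` / `ProjectsOnto`; see `…StubCliqueProjectsXor.lean`). Everything is [folklore]
(Gaussian-elimination width gadgets; cf. Göös–Kamath–Robere–Sokolov 2019 for the XOR-SAT function).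
-/

set_option linter.dupNamespace false -- `Summit.PneNP.PneNP.…`: summit = sub-problem (D-0017)

namespace Summit.PneNP.PneNP.Theorems.XorDoor.CliqueXor

open Finset

/-- An equation `(a, b, c, β)`, read `y a + y b + y c = β`, of the 3-sparse pool on `n` variables
(reducibly the line's `Pool n`). -/
local notation "E3[" n "]" => (Fin n × Fin n × Fin n × ZMod 2)

/-! ## §1 Derivations of `0 = 1` over `𝔽₂` -/

variable {n : ℕ}

/-- In `ZMod 2`, non-zero means `1`. [folklore] -/
theorem eq_one_of_ne_zero : ∀ x : ZMod 2, x ≠ 0 → x = 1 := by decide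

/-- Coefficient of the variable `i` in the equation `e = (a, b, c, β)`:
`[a = i] + [b = i] + [c = i] ∈ 𝔽₂`. [folklore] -/
def coef (e : E3[n]) (i : Fin n) : ZMod 2 :=
  (if e.1 = i then 1 else 0) + (if e.2.1 = i then 1 else 0) + (if e.2.2.1 = i then 1 else 0)

/-- Bridge: the left-hand side of `e` at `y` is `∑ i, coef e i * y i`. [folklore] -/
theorem lhs_eq_sum_coef (y : Fin n → ZMod 2) (e : E3[n]) :
    y e.1 + y e.2.1 + y e.2.2.1 = ∑ i, coef e i * y i := by
  simp only [coef, add_mul, Finset.sum_add_distrib, ite_mul, one_mul, zero_mul,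
    Finset.sum_ite_eq, Finset.mem_univ, if_true]

/-- **A derivation of `0 = 1` refutes the system.** If weights `w j ∈ 𝔽₂` on equations `eqn j`,
supported on `v`-selected equations, kill every variable and have right-hand side `1`, then the
`v`-selected system is unsatisfiable (`0 = ∑ w_j (lhs_j y - rhs_j) = 0 - 1`). [folklore] -/
theorem unsat_of_deriv {L : ℕ} (eqn : Fin L → E3[n]) (w : Fin L → ZMod 2) (v : E3[n] → Bool)
    (hsel : ∀ j, w j ≠ 0 → v (eqn j) = true)
    (hvar : ∀ i : Fin n, ∑ j, w j * coef (eqn j) i = 0)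
    (hrhs : ∑ j, w j * (eqn j).2.2.2 = 1) :
    ¬ ∃ y : Fin n → ZMod 2, ∀ e : E3[n], v e = true → y e.1 + y e.2.1 + y e.2.2.1 = e.2.2.2 := by
  rintro ⟨y, hy⟩
  have hterm (j) : w j * (y (eqn j).1 + y (eqn j).2.1 + y (eqn j).2.2.1) = w j * (eqn j).2.2.2 := by
    by_cases hj : w j = 0
    · simp [hj]
    · rw [hy _ (hsel j hj)]
  have hlhs : ∑ j, w j * (y (eqn j).1 + y (eqn j).2.1 + y (eqn j).2.2.1) = 0 := by
    calc ∑ j, w j * (y (eqn j).1 + y (eqn j).2.1 + y (eqn j).2.2.1)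
        = ∑ j, ∑ i, w j * coef (eqn j) i * y i := by
          refine Finset.sum_congr rfl fun j _ => ?_
          rw [lhs_eq_sum_coef, Finset.mul_sum]
          refine Finset.sum_congr rfl fun i _ => ?_
          ring
      _ = ∑ i, (∑ j, w j * coef (eqn j) i) * y i := by
          rw [Finset.sum_comm]
          refine Finset.sum_congr rfl fun i _ => ?_
          rw [Finset.sum_mul]
      _ = 0 := by simp [hvar]
  exact zero_ne_one (hlhs.symm.trans ((Finset.sum_congr rfl fun j _ => hterm j).trans hrhs))

/-- **Unsatisfiable ⇒ a derivation of `0 = 1`** (linear-algebra duality over the field `𝔽₂`): if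
the `v`-selected system has no solution, some `𝔽₂`-combination `lam` of selected equations kills
every variable and has right-hand side `1` (the right-hand side vector is outside the range of the
masked coefficient map, so some linear functional vanishes on the range but not on it). [folklore] -/
theorem exists_deriv_of_unsat (v : E3[n] → Bool)
    (h : ¬ ∃ y : Fin n → ZMod 2, ∀ e : E3[n], v e = true → y e.1 + y e.2.1 + y e.2.2.1 = e.2.2.2) :
    ∃ lam : E3[n] → ZMod 2, (∀ e, lam e ≠ 0 → v e = true) ∧
      (∀ i : Fin n, ∑ e, lam e * coef e i = 0) ∧ ∑ e, lam e * e.2.2.2 = 1 := by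
  classical
  let A : (Fin n → ZMod 2) →ₗ[ZMod 2] (E3[n] → ZMod 2) :=
    { toFun := fun y e => if v e = true then y e.1 + y e.2.1 + y e.2.2.1 else 0
      map_add' := fun y y' => by
        funext e
        simp only [Pi.add_apply]
        split_ifs <;> ring
      map_smul' := fun a y => by
        funext e
        simp only [Pi.smul_apply, smul_eq_mul, RingHom.id_apply]
        split_ifs <;> ring }
  have hA : ∀ y e, A y e = if v e = true then y e.1 + y e.2.1 + y e.2.2.1 else 0 := fun _ _ => rfl
  let b : E3[n] → ZMod 2 := fun e => if v e = true then e.2.2.2 else 0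
  have hb : b ∉ LinearMap.range A := by
    rintro ⟨y, hy⟩
    refine h ⟨y, fun e he => ?_⟩
    simpa [hA, b, he] using congr_fun hy e
  obtain ⟨f, hfb, hker⟩ := Submodule.exists_le_ker_of_notMem hb
  have hfA (y) : f (A y) = 0 := LinearMap.mem_ker.1 (hker (LinearMap.mem_range_self A y))
  let μ : E3[n] → ZMod 2 := fun e => f fun e' => if e = e' then 1 else 0
  have hf (x : E3[n] → ZMod 2) : f x = ∑ e, x e * μ e := by
    simp only [LinearMap.pi_apply_eq_sum_univ f x, smul_eq_mul, μ]
  refine ⟨fun e => if v e = true then μ e else 0, fun e he => by_contra fun hv => he (if_neg hv),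
    fun i => ?_, ?_⟩
  · have h0 := hfA fun i' => if i' = i then 1 else 0
    rw [hf] at h0
    refine Eq.trans (Finset.sum_congr rfl fun e _ => ?_) h0
    rw [hA]
    simp only [coef]
    split_ifs <;> ring
  · have h1 : f b = 1 := eq_one_of_ne_zero _ hfb
    rw [hf] at h1
    refine Eq.trans (Finset.sum_congr rfl fun e _ => ?_) h1
    simp only [b]
    split_ifs <;> ring

/-! ## §2 The derivation gadget -/

variable {L : ℕ}

/-- Contribution of the equation `e` at the coordinate `i` (`none` = the right-hand side). [folklore] -/
def contrib (e : E3[n]) : Option (Fin n) → ZMod 2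
  | none => e.2.2.2
  | some i => coef e i

/-- The target `(0, …, 0 ∣ 1)` of a derivation of `0 = 1`. [folklore] -/
def target (n : ℕ) : Option (Fin n) → ZMod 2
  | none => 1
  | some _ => 0

/-- Re-indexing a `Fin L`-sum written over `range L` with a dependent `if`. [folklore] -/
theorem sum_range_dite (f : (j : ℕ) → j < L → ZMod 2) :
    ∑ j ∈ Finset.range L, (if h : j < L then f j h else 0) = ∑ j : Fin L, f j j.isLt := by
  rw [← Fin.sum_univ_eq_sum_range]
  exact Finset.sum_congr rfl fun j _ => dif_pos j.isLt

/-- In `ZMod 2`: `[x ≠ 0] · t = x * t`. [folklore] -/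
theorem ite_ne_zero_eq_mul : ∀ x t : ZMod 2, (if x ≠ 0 then t else 0) = x * t := by decide

/-- The vertices of the derivation gadget: at step `j` and coordinate `i` (`none` = right-hand
side), the state bit `b` before the step and the decision `c` whether the step's equation is used.
[folklore] -/
structure Vtx (n L : ℕ) where
  /-- the step -/
  j : Fin L
  /-- the coordinate (`none` = right-hand side) -/
  i : Option (Fin n)
  /-- the state bit before the step -/
  b : ZMod 2
  /-- is the step's equation used? -/
  c : Bool
  deriving DecidableEq, Fintype

variable (eqn : Fin L → E3[n])

/-- The increment of the state bit at a vertex: the contribution of the step's equation if used.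
[folklore] -/
def inc (p : Vtx n L) : ZMod 2 := if p.c = true then contrib (eqn p.j) p.i else 0

/-- The state bit after the step. [folklore] -/
def aft (p : Vtx n L) : ZMod 2 := p.b + inc eqn p

/-- Boundary conditions: state `0` before the first step, the target after the last one. [folklore] -/
def Valid (p : Vtx n L) : Prop :=
  ((p.j : ℕ) = 0 → p.b = 0) ∧ ((p.j : ℕ) + 1 = L → aft eqn p = target n p.i)

/-- Pairwise consistency: same step ⇒ same decision; consecutive steps at the same coordinate ⇒
the state is handed over. [folklore] -/
def Compat (p q : Vtx n L) : Prop :=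
  (p.j = q.j → p.c = q.c) ∧ ((q.j : ℕ) = p.j + 1 → q.i = p.i → aft eqn p = q.b) ∧
    ((p.j : ℕ) = q.j + 1 → p.i = q.i → aft eqn q = p.b)

/-- Adjacency of the gadget at the input `v`: distinct positions, both vertices valid, consistent,
and every used equation selected by `v` (the AND-mask). [folklore] -/
def Good (v : E3[n] → Bool) (p q : Vtx n L) : Prop :=
  (p.j, p.i) ≠ (q.j, q.i) ∧ Valid eqn p ∧ Valid eqn q ∧ Compat eqn p q ∧
    (p.c = true → v (eqn p.j) = true) ∧ (q.c = true → v (eqn q.j) = true)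

/-- `Compat` is symmetric. [folklore] -/
theorem compat_comm {p q : Vtx n L} : Compat eqn p q ↔ Compat eqn q p :=
  ⟨fun ⟨h1, h2, h3⟩ => ⟨fun h => (h1 h.symm).symm, h3, h2⟩,
    fun ⟨h1, h2, h3⟩ => ⟨fun h => (h1 h.symm).symm, h3, h2⟩⟩

/-- `Good` is symmetric. [folklore] -/
theorem good_comm {v : E3[n] → Bool} {p q : Vtx n L} : Good eqn v p q ↔ Good eqn v q p :=
  ⟨fun ⟨h1, h2, h3, h4, h5, h6⟩ => ⟨Ne.symm h1, h3, h2, (compat_comm eqn).1 h4, h6, h5⟩,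
    fun ⟨h1, h2, h3, h4, h5, h6⟩ => ⟨Ne.symm h1, h3, h2, (compat_comm eqn).1 h4, h6, h5⟩⟩

/-- **Soundness of the gadget.** A family of pairwise-adjacent vertices, one at every position
`(step, coordinate)`, is a derivation of `0 = 1` from `v`-selected equations (the decisions are
constant along each step, the states telescope from `0` to the target), so the `v`-selected system
is unsatisfiable. [folklore] -/
theorem unsat_of_family (hn : 0 < n) (hL : 0 < L) (v : E3[n] → Bool)
    (vert : Fin L × Option (Fin n) → Vtx n L)
    (hj : ∀ π, (vert π).j = π.1) (hi : ∀ π, (vert π).i = π.2)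
    (hgood : ∀ π π', π ≠ π' → Good eqn v (vert π) (vert π')) :
    ¬ ∃ y : Fin n → ZMod 2, ∀ e : E3[n], v e = true → y e.1 + y e.2.1 + y e.2.2.1 = e.2.2.2 := by
  have hval : ∀ π, Valid eqn (vert π) := by
    rintro ⟨j, i⟩
    cases i with
    | none => exact (hgood (j, none) (j, some ⟨0, hn⟩) (by simp)).2.1
    | some i => exact (hgood (j, some i) (j, none) (by simp)).2.1
  have hcj (j i) : (vert (j, i)).c = (vert (j, none)).c := by
    cases i with
    | none => rfl
    | some i =>
      exact (hgood (j, some i) (j, none) (by simp)).2.2.2.1.1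
        ((hj (j, some i)).trans (hj (j, none)).symm)
  have hsel (j) (hc : (vert (j, none)).c = true) : v (eqn j) = true := by
    simpa only [hj] using (hgood (j, none) (j, some ⟨0, hn⟩) (by simp)).2.2.2.2.1 hc
  have htel : ∀ i, ∑ j, (if (vert (j, none)).c = true then contrib (eqn j) i else 0)
      = target n i := by
    intro i
    let st : ℕ → ZMod 2 := fun j => if h : j < L then (vert (⟨j, h⟩, i)).b else target n i
    let T : ℕ → ZMod 2 := fun j => if h : j < L then inc eqn (vert (⟨j, h⟩, i)) else 0
    have hst : ∀ j, j ≤ L → st j = ∑ j' ∈ Finset.range j, T j' := by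
      intro j
      induction j with
      | zero =>
        intro _
        simp only [st, dif_pos hL, Finset.range_zero, Finset.sum_empty]
        exact (hval (⟨0, hL⟩, i)).1 (by simp [hj])
      | succ j ih =>
        intro hjL
        have hjL' : j < L := hjL
        rw [Finset.sum_range_succ, ← ih hjL'.le]
        have haft : aft eqn (vert (⟨j, hjL'⟩, i)) = st j + T j := by
          simp only [st, T, dif_pos hjL', aft]
        rw [← haft]
        by_cases hlast : j + 1 < L
        · simp only [st, dif_pos hlast]
          exact ((hgood (⟨j, hjL'⟩, i) (⟨j + 1, hlast⟩, i) (by simp)).2.2.2.1.2.1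
            (by simp [hj]) (by simp [hi])).symm
        · simp only [st, dif_neg hlast]
          rw [(hval (⟨j, hjL'⟩, i)).2 (by simp [hj]; omega), hi]
    have hfin := hst L le_rfl
    simp only [st, dif_neg (lt_irrefl L)] at hfin
    calc ∑ j, (if (vert (j, none)).c = true then contrib (eqn j) i else 0)
        = ∑ j : Fin L, inc eqn (vert (j, i)) := by
          refine Finset.sum_congr rfl fun j _ => ?_
          simp only [inc, hcj, hj, hi]
      _ = ∑ j' ∈ Finset.range L, T j' :=
          (sum_range_dite fun j h => inc eqn (vert (⟨j, h⟩, i))).symm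
      _ = target n i := hfin.symm
  refine unsat_of_deriv eqn (fun j => if (vert (j, none)).c = true then 1 else 0) v ?_ ?_ ?_
  · intro j hj0
    by_cases hc : (vert (j, none)).c = true
    · exact hsel j hc
    · exact absurd (if_neg hc) hj0
  · intro i
    have h := htel (some i)
    simp only [contrib, target] at h
    simpa only [ite_mul, one_mul, zero_mul] using h
  · have h := htel none
    simp only [contrib, target] at h
    simpa only [ite_mul, one_mul, zero_mul] using h

/-- **Completeness of the gadget.** A derivation of `0 = 1` with weights `w j` on the equations
`eqn j`, supported on `v`-selected equations, yields a pairwise-adjacent family with one vertex at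
every position: decisions `[w j ≠ 0]`, states the partial sums of the derivation. [folklore] -/
theorem family_of_deriv (v : E3[n] → Bool) (w : Fin L → ZMod 2)
    (hsel : ∀ j, w j ≠ 0 → v (eqn j) = true)
    (hvar : ∀ i : Fin n, ∑ j, w j * coef (eqn j) i = 0)
    (hrhs : ∑ j, w j * (eqn j).2.2.2 = 1) :
    ∃ vert : Fin L × Option (Fin n) → Vtx n L, (∀ π, (vert π).j = π.1) ∧
      (∀ π, (vert π).i = π.2) ∧ ∀ π π', π ≠ π' → Good eqn v (vert π) (vert π') := by
  let T : Option (Fin n) → ℕ → ZMod 2 := fun i j =>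
    if h : j < L then w ⟨j, h⟩ * contrib (eqn ⟨j, h⟩) i else 0
  let B : Option (Fin n) → ℕ → ZMod 2 := fun i j => ∑ j' ∈ Finset.range j, T i j'
  have hBL : ∀ i, B i L = target n i := by
    intro i
    have hB : B i L = ∑ j : Fin L, w j * contrib (eqn j) i :=
      sum_range_dite fun j h => w ⟨j, h⟩ * contrib (eqn ⟨j, h⟩) i
    rw [hB]
    cases i with
    | none => simpa only [contrib, target] using hrhs
    | some i => simpa only [contrib, target] using hvar i
  let mk : Fin L × Option (Fin n) → Vtx n L := fun π => ⟨π.1, π.2, B π.2 π.1, decide (w π.1 ≠ 0)⟩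
  have hinc (π) : inc eqn (mk π) = T π.2 π.1 := by
    simp only [inc, mk, T, dif_pos π.1.isLt, Fin.eta, decide_eq_true_eq]
    exact ite_ne_zero_eq_mul _ _
  have haft (π) : aft eqn (mk π) = B π.2 (π.1 + 1) := by
    rw [aft, hinc]
    simp only [mk, B, Finset.sum_range_succ]
  have hvalid : ∀ π, Valid eqn (mk π) := by
    intro π
    refine ⟨fun h0 => ?_, fun hlast => ?_⟩
    · simp only [mk] at h0 ⊢
      simp only [B, h0, Finset.range_zero, Finset.sum_empty]
    · rw [haft]
      simp only [mk] at hlast ⊢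
      rw [hlast, hBL]
  refine ⟨mk, fun _ => rfl, fun _ => rfl, fun π π' hne => ?_⟩
  refine ⟨?_, hvalid π, hvalid π', ⟨fun h => ?_, fun h1 h2 => ?_, fun h1 h2 => ?_⟩, fun hc => ?_,
    fun hc => ?_⟩
  · simpa only [mk, ne_eq, Prod.mk.injEq, Prod.ext_iff] using hne
  · simp only [mk] at h ⊢
    rw [h]
  · simp only [mk] at h1 h2 ⊢
    rw [haft, h2, h1]
  · simp only [mk] at h1 h2 ⊢
    rw [haft, h2, h1]
  · simp only [mk, decide_eq_true_eq] at hc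
    exact hsel _ hc
  · simp only [mk, decide_eq_true_eq] at hc
    exact hsel _ hc

/-! ## §3 The gadget as a vertex set of `K_M` -/

/-- The number `M` of vertices of the gadget. [folklore] -/
def M (n L : ℕ) : ℕ := Fintype.card (Vtx n L)

/-- An enumeration of the vertices of the gadget. [folklore] -/
noncomputable def eV (n L : ℕ) : Vtx n L ≃ Fin (M n L) := Fintype.equivFin _

/-- `M ≤ 4 L (n + 1)`. [folklore] -/
theorem M_le : M n L ≤ L * ((n + 1) * (2 * 2)) := by
  have h : Fintype.card (Fin L × Option (Fin n) × ZMod 2 × Bool) = L * ((n + 1) * (2 * 2)) := by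
    simp only [Fintype.card_prod, Fintype.card_fin, Fintype.card_option, ZMod.card,
      Fintype.card_bool]
  rw [M, ← h]
  refine Fintype.card_le_of_injective (fun p => (p.j, p.i, p.b, p.c))
    fun ⟨_, _, _, _⟩ ⟨_, _, _, _⟩ hpq => ?_
  simp only [Prod.mk.injEq] at hpq
  obtain ⟨rfl, rfl, rfl, rfl⟩ := hpq
  rfl

/-- **The clique characterisation of the gadget** (for `n ≥ 1` variables and the steps enumerating
the pool through `eqv`): a set of `L (n + 1)` pairwise-adjacent vertices exists iff the
`v`-selected system is unsatisfiable. (⇒) distinct adjacent vertices sit at distinct positions, so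
such a set has exactly one vertex at every position and `unsat_of_family` applies; (⇐)
`exists_deriv_of_unsat` and `family_of_deriv`. [folklore] -/
theorem xorGadget_goodSet_iff :
    ∀ {n L : ℕ}, 0 < n → ∀ (eqv : Fin L ≃ Fin n × Fin n × Fin n × ZMod 2)
      (v : Fin n × Fin n × Fin n × ZMod 2 → Bool),
      (∃ S : Finset (Fin (M n L)), S.card = L * (n + 1) ∧
          ∀ u ∈ S, ∀ u' ∈ S, u ≠ u' → Good eqv v ((eV n L).symm u) ((eV n L).symm u')) ↔
        ¬ ∃ y : Fin n → ZMod 2, ∀ e : Fin n × Fin n × Fin n × ZMod 2, v e = true →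
          y e.1 + y e.2.1 + y e.2.2.1 = e.2.2.2 := by
  intro n L hn eqv v
  have hL : 0 < L := by
    have h : 0 < Fintype.card (E3[n]) :=
      Fintype.card_pos_iff.2 ⟨(⟨0, hn⟩, ⟨0, hn⟩, ⟨0, hn⟩, 0)⟩
    rwa [← Fintype.card_congr eqv, Fintype.card_fin] at h
  have hcardPos : Fintype.card (Fin L × Option (Fin n)) = L * (n + 1) := by simp
  constructor
  · rintro ⟨S, hcard, hS⟩
    let f : S → Fin L × Option (Fin n) := fun u =>
      (((eV n L).symm u.1).j, ((eV n L).symm u.1).i)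
    have hf : Function.Injective f := by
      rintro ⟨u, hu⟩ ⟨u', hu'⟩ h
      by_contra hne
      have hne' : u ≠ u' := fun h' => hne (Subtype.ext h')
      exact (hS u hu u' hu' hne').1 h
    have hbij : Function.Bijective f := by
      rw [Fintype.bijective_iff_injective_and_card]
      exact ⟨hf, by rw [Fintype.card_coe, hcard, hcardPos]⟩
    let g := Equiv.ofBijective f hbij
    refine unsat_of_family eqv hn hL v (fun π => (eV n L).symm (g.symm π).1)
      (fun π => congrArg Prod.fst (g.apply_symm_apply π))
      (fun π => congrArg Prod.snd (g.apply_symm_apply π)) fun π π' hne => ?_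
    have hne' : (g.symm π).1 ≠ (g.symm π').1 := fun h =>
      hne (g.symm.injective (Subtype.ext h))
    exact hS _ (g.symm π).2 _ (g.symm π').2 hne'
  · intro h
    obtain ⟨lam, hsel, hvar, hrhs⟩ := exists_deriv_of_unsat v h
    obtain ⟨vert, hj, hi, hgood⟩ := family_of_deriv eqv v (lam ∘ eqv)
      (fun j hj0 => hsel _ hj0)
      (fun i => by rw [← hvar i]; exact Equiv.sum_comp eqv (fun e => lam e * coef e i))
      (by rw [← hrhs]; exact Equiv.sum_comp eqv (fun e => lam e * e.2.2.2))
    have hinj : Function.Injective fun π => eV n L (vert π) := by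
      intro π π' hππ
      have h' := (eV n L).injective hππ
      exact Prod.ext (by rw [← hj π, ← hj π', h']) (by rw [← hi π, ← hi π', h'])
    refine ⟨Finset.univ.image fun π => eV n L (vert π), ?_, ?_⟩
    · rw [Finset.card_image_of_injective _ hinj, Finset.card_univ, hcardPos]
    · intro u hu u' hu' hne
      obtain ⟨π, -, rfl⟩ := Finset.mem_image.1 hu
      obtain ⟨π', -, rfl⟩ := Finset.mem_image.1 hu'
      rw [Equiv.symm_apply_apply, Equiv.symm_apply_apply]
      exact hgood π π' fun hππ => hne (by rw [hππ])

end Summit.PneNP.PneNP.Theorems.XorDoor.CliqueXor
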